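import Mathlib.RepresentationTheory.Homological.GroupCohomology.Hilbert90
import Mathlib.RingTheory.Valuation.Basic
import Mathlib.GroupTheory.Index
import Literature.NumberTheory.GaloisRepresentations.LocalReciprocityLawDischargeProofs
import HarnessLib

/-!
# Brick (b), local atom — IV: THE CYCLIC INPUTS OF THE DEVISSAGE — `Ĥ⁻¹(⟨τ⟩, U_L)` is generated by `π/τπ` (Hilbert 90),
# and `[H : pH] ≤ [V : pV]` for a subgroup `H ≤ V` of finite index

Cell `bsd-print-cf2` (HOME `run/shared/lean/pub/bsd-print-cf2/`), width seat `bsd-line-cf2c-w5` g11, brick §4(b) (units side),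
crux of record stmt-BirchSwinnertonDyer-24721 (deciding door 23300, (U1) f.g. half = the LOCAL ATOM). THESES-FREE; theorems only
(no `def`, no named fact, no `sorry`); generic field / group algebra (Mathlib-only imports). Supplies the hypotheses (hX₁)/(hX₂)
and (hN) of the two-step devissage `LeopoldtAtV.exists_cover_of_devissage` (`…LeopoldtUnitsLocalDevissage.lean`, p744096):

* ★ `exists_zpow_mul_div_of_norm_eq_one` — **`Ĥ⁻¹(⟨τ⟩, Lˣ/v) `: in a finite cyclic Galois extension `L/K` with generator `τ`
  and a `τ`-invariant valuation `v` whose value group is generated by `v π` (`π` "a uniformizer"), every `x` of norm `1` is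
  `(π/τπ)^k · (u/τu)` with `v u = 1`** — Mathlib's Hilbert 90 `groupCohomology.exists_div_of_norm_eq_one` (`x = y/τy`) and
  `y = π^k·u`. Read on the units `U = {v = 1}`: `ker(N_{L/K}) ∩ U ⊆ (π/τπ)^ℤ · (τ−1)U`, i.e. `Ĥ⁻¹(⟨τ⟩, U)` is CYCLIC, generated
  by the class of `π/τπ` (of order the ramification index) — hypothesis (hX₁) of the devissage, and (hX₂) for `M/L₀`;
* `relIndex_nsmul_le` — **`[H : pH] ≤ [V : pV]`** for `H ≤ V` of finite index with `[V : pV]` finite (any abelian group, any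
  `p : ℕ`): the `p`-th power map induces `V/H ↠ pV/pH`; with `exists_finset_cover_of_relIndex` (finite index ⟹ a finite set
  of translates covers) this is hypothesis (hN) of the devissage for `H = N_D(U¹_L) ≤ V = U¹_{L₀}` (`[U¹_{L₀} : (U¹_{L₀})^p]`
  finite for a local field — ty2's `index_pow_range_units_integer_eq`).

* ★ `exists_generator_mod_norms` — **`Fˣ/N_{E/F}(Eˣ)` is CYCLIC** for a finite cyclic `E ⊆ F̄` over a non-archimedean local field
  `F` (the tree's PROVED local reciprocity law `GaloisRepresentations.localReciprocityLaw_holds`, Serre XIII §4) — the source of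
  hypothesis (hT) (`F := M = L^I`, `E := L`; the restriction to units and the transport of an abstract `L/M` into `M̄` are left
  to the assembler).

HONEST FRAMING: generic algebra + one application of the tree's local reciprocity; nothing here closes 24721/23300; BSD is not
proved by any of this.

## References
* [SerreLocalFields1979] J.-P. Serre, *Local Fields*, GTM 67 (1979), Ch. X §1 (Hilbert 90), Ch. XIII §4.
* [NeukirchANT1999] J. Neukirch, *Algebraic Number Theory* (1999), Ch. IV (6.2) (`H⁻¹` of units), Ch. II (5.8).
-/

set_option linter.dupNamespace false -- D-0017: single-problem summit, `…BirchSwinnertonDyer.BirchSwinnertonDyer…` repeats a namespace by design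
set_option autoImplicit false

namespace Summit.BirchSwinnertonDyer.BirchSwinnertonDyer.Theorems.PrintCf2.LeopoldtAtV

/-! ### §1. `Ĥ⁻¹` of the units in a cyclic extension: Hilbert 90 and a uniformizer -/

/-- ★ **Norm-one elements in a cyclic extension with an invariant discrete-type valuation**: if `L/K` is finite cyclic Galois
with generator `τ`, `v` a valuation on `L` with `v ∘ τ = v` whose non-zero values are the powers of `v π`, then every `x ∈ L`
with `N_{L/K}(x) = 1` is `x = (π/τπ)^k · (u/τu)` with `u ≠ 0`, `v u = 1`. (Hilbert 90: `x = y/τy`; `y = π^k u`.) So on the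
units `{v = 1}` the norm-one classes modulo `(τ−1)`-coboundaries are the powers of the class of `π/τπ`.
[cite: SerreLocalFields1979, Ch. X §1 Prop. 2] [cite: NeukirchANT1999, Ch. IV (6.2)] -/
theorem exists_zpow_mul_div_of_norm_eq_one {K L : Type} [Field K] [Field L] [Algebra K L] [FiniteDimensional K L]
    [IsGalois K L] [IsCyclic (L ≃ₐ[K] L)] {τ : L ≃ₐ[K] L} (hτ : ∀ g, g ∈ Subgroup.zpowers τ)
    {Γ₀ : Type*} [LinearOrderedCommGroupWithZero Γ₀] (v : Valuation L Γ₀)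
    (π : L) (hπ0 : π ≠ 0) (hπ : ∀ x : L, x ≠ 0 → ∃ k : ℤ, v x = v π ^ k) {x : L} (hN : Algebra.norm K x = 1) :
    ∃ (k : ℤ) (u : L), u ≠ 0 ∧ v u = 1 ∧ x = (π / τ π) ^ k * (u / τ u) := by
  obtain ⟨y, hy⟩ := groupCohomology.exists_div_of_norm_eq_one hτ hN
  have hy0 : ((y : Lˣ) : L) ≠ 0 := y.ne_zero
  obtain ⟨k, hk⟩ := hπ _ hy0
  have hπk : π ^ k ≠ 0 := zpow_ne_zero k hπ0
  have hvπ : v π ≠ 0 := (Valuation.ne_zero_iff v).2 hπ0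
  refine ⟨k, (y : L) / π ^ k, div_ne_zero hy0 hπk, ?_, ?_⟩
  · rw [map_div₀, map_zpow₀, hk, div_self (zpow_ne_zero k hvπ)]
  · have hτπ : τ π ≠ 0 := (map_ne_zero τ).2 hπ0
    have hτu : τ ((y : L) / π ^ k) ≠ 0 := (map_ne_zero τ).2 (div_ne_zero hy0 hπk)
    rw [← hy]
    rw [show ((y : Lˣ) : L) = π ^ k * ((y : L) / π ^ k) by rw [mul_div_cancel₀ _ hπk]]
    rw [map_mul, map_zpow₀, mul_div_mul_comm, div_zpow, mul_div_cancel₀ _ hπk]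

/-- For a `τ`-invariant valuation the generator `π/τπ` of `Ĥ⁻¹` is a unit: `v (π/τπ) = 1`. [folklore] -/
theorem valuation_div_map_eq_one {K L : Type*} [Field K] [Field L] [Algebra K L] (τ : L ≃ₐ[K] L)
    {Γ₀ : Type*} [LinearOrderedCommGroupWithZero Γ₀] (v : Valuation L Γ₀) (hv : ∀ x, v (τ x) = v x)
    {π : L} (hπ0 : π ≠ 0) : v (π / τ π) = 1 := by
  rw [map_div₀, hv, div_self ((Valuation.ne_zero_iff v).2 hπ0)]

/-- For a `τ`-invariant valuation, `(τ−1)`-coboundaries of units are units: `v (u/τu) = 1` for `v u = 1`. [folklore] -/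
theorem valuation_div_map_eq_one_of_eq_one {K L : Type*} [Field K] [Field L] [Algebra K L] (τ : L ≃ₐ[K] L)
    {Γ₀ : Type*} [LinearOrderedCommGroupWithZero Γ₀] (v : Valuation L Γ₀) (hv : ∀ x, v (τ x) = v x)
    {u : L} (hu : v u = 1) : v (u / τ u) = 1 := by
  rw [map_div₀, hv, hu, div_one]

/-! ### §2. `[H : pH] ≤ [V : pV]` for a subgroup of finite index, and finite covers -/

section Index

variable {A : Type*} [AddCommGroup A]

/-- The image `p·X` of a subgroup under multiplication by `p` lies in `X`. [folklore] -/
theorem map_nsmul_le (p : ℕ) (X : AddSubgroup A) : X.map (DistribSMul.toAddMonoidHom A p) ≤ X := by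
  rintro _ ⟨x, hx, rfl⟩
  exact X.nsmul_mem hx p

/-- ★ **`[H : pH] ≤ [V : pV]`** for subgroups `H ≤ V` of an abelian group with `[V : H]` and `[V : pV]` finite: multiplication by
`p` induces a surjection `V/H ↠ pV/pH`, so `[pV : pH] ≤ [V : H]`, and `[H : pH]·[V : H] = [V : pH] = [pV : pH]·[V : pV]`.
(With `V = U¹_{L₀}`, `H = N_D(U¹_L)`: the bound `[N_D U¹_L : (N_D U¹_L)^p] ≤ [U¹_{L₀} : (U¹_{L₀})^p]`.)
[cite: NeukirchANT1999, Ch. II (5.8)] -/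
theorem relIndex_map_nsmul_le (p : ℕ) (H V : AddSubgroup A) (hHV : H ≤ V) (hH : H.relIndex V ≠ 0) :
    (H.map (DistribSMul.toAddMonoidHom A p)).relIndex H ≤ (V.map (DistribSMul.toAddMonoidHom A p)).relIndex V := by
  set φ := DistribSMul.toAddMonoidHom A p with hφ
  have hφH : H.map φ ≤ H := map_nsmul_le p H
  have hφV : V.map φ ≤ V := map_nsmul_le p V
  have hφHV : H.map φ ≤ V.map φ := AddSubgroup.map_mono hHV
  have e1 := AddSubgroup.relIndex_mul_relIndex (H.map φ) H V hφH hHV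
  have e2 := AddSubgroup.relIndex_mul_relIndex (H.map φ) (V.map φ) V hφHV hφV
  -- the surjection `V/H ↠ pV/pH`
  let f : ↥V →+ ↥(V.map φ) := (φ.comp V.subtype).codRestrict (V.map φ) fun x ↦ ⟨x, x.2, rfl⟩
  have hf : Function.Surjective f := by
    rintro ⟨y, hy⟩
    obtain ⟨x, hx, rfl⟩ := hy
    exact ⟨⟨x, hx⟩, rfl⟩
  have hmap : (H.addSubgroupOf V).map f = (H.map φ).addSubgroupOf (V.map φ) := by
    ext ⟨y, hy⟩
    simp only [AddSubgroup.mem_map, AddSubgroup.mem_addSubgroupOf]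
    constructor
    · rintro ⟨⟨x, hxV⟩, hxH, hxy⟩
      have : φ x = y := congrArg Subtype.val hxy
      exact ⟨x, hxH, this⟩
    · rintro ⟨x, hxH, hxy⟩
      exact ⟨⟨x, hHV hxH⟩, hxH, Subtype.ext hxy⟩
  have hdvd : (H.map φ).relIndex (V.map φ) ∣ H.relIndex V := by
    have h := AddSubgroup.index_map_dvd (H.addSubgroupOf V) hf
    rwa [hmap] at h
  have hle : (H.map φ).relIndex (V.map φ) ≤ H.relIndex V := Nat.le_of_dvd (Nat.pos_of_ne_zero hH) hdvd
  have key : (H.map φ).relIndex H * H.relIndex V ≤ (V.map φ).relIndex V * H.relIndex V := by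
    rw [e1, ← e2, mul_comm]
    exact Nat.mul_le_mul_left _ hle
  exact Nat.le_of_mul_le_mul_right key (Nat.pos_of_ne_zero hH)

/-- **A subgroup of finite index is covered by finitely many translates**: for `K ≤ H` with `[H : K]` finite there is a finite
`S ⊆ H` with `#S ≤ [H : K]` and `H ⊆ S + K`. [folklore] -/
theorem exists_finset_cover_of_relIndex (K H : AddSubgroup A) (hfin : K.relIndex H ≠ 0) :
    ∃ S : Finset A, (∀ s ∈ S, s ∈ H) ∧ S.card ≤ K.relIndex H ∧ ∀ h ∈ H, ∃ s ∈ S, h - s ∈ K := by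
  classical
  haveI : (K.addSubgroupOf H).FiniteIndex := ⟨hfin⟩
  haveI : Fintype (↥H ⧸ K.addSubgroupOf H) := Fintype.ofFinite _
  refine ⟨(Finset.univ : Finset (↥H ⧸ K.addSubgroupOf H)).image fun q ↦ ((Quotient.out q : ↥H) : A), ?_, ?_, ?_⟩
  · intro s hs
    obtain ⟨q, -, rfl⟩ := Finset.mem_image.1 hs
    exact (Quotient.out q).2
  · refine Finset.card_image_le.trans ?_
    rw [Finset.card_univ, ← Nat.card_eq_fintype_card]
    rfl
  · intro h hh
    refine ⟨((Quotient.out (QuotientAddGroup.mk (⟨h, hh⟩ : ↥H) : ↥H ⧸ K.addSubgroupOf H) : ↥H) : A),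
      Finset.mem_image.2 ⟨_, Finset.mem_univ _, rfl⟩, ?_⟩
    have hq := QuotientAddGroup.out_eq' (QuotientAddGroup.mk (⟨h, hh⟩ : ↥H) : ↥H ⧸ K.addSubgroupOf H)
    rw [QuotientAddGroup.eq, AddSubgroup.mem_addSubgroupOf] at hq
    have : -((Quotient.out (QuotientAddGroup.mk (⟨h, hh⟩ : ↥H) : ↥H ⧸ K.addSubgroupOf H) : ↥H) : A) + h ∈ K := hq
    rwa [neg_add_eq_sub] at this

/-- ★ **Hypothesis (hN) of the devissage from an index bound**: if an additive map `N : A → A` (the norm `N_D`) takes values in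
a subgroup `V` (`= U¹_{L₀}`) in which `N(A)` has finite index and `[V : pV] ≤ B₀`, then `N(A)/p·N(A)` is covered by `B₀` classes
of norms. [cite: NeukirchANT1999, Ch. II (5.8)] -/
theorem exists_norm_cover_of_relIndex (p B₀ : ℕ) (N : A →+ A) (V : AddSubgroup A) (hNV : ∀ a, N a ∈ V)
    (hfin : N.range.relIndex V ≠ 0) (hV : (V.map (DistribSMul.toAddMonoidHom A p)).relIndex V ≠ 0)
    (hB : (V.map (DistribSMul.toAddMonoidHom A p)).relIndex V ≤ B₀) :
    ∃ S : Finset A, S.card ≤ B₀ ∧ ∀ a, ∃ s ∈ S, ∃ a', N a = N s + p • N a' := by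
  classical
  have hle : N.range ≤ V := fun x ⟨a, ha⟩ ↦ ha ▸ hNV a
  have hidx := relIndex_map_nsmul_le p N.range V hle hfin
  have hfin' : (N.range.map (DistribSMul.toAddMonoidHom A p)).relIndex N.range ≠ 0 := by
    intro h0
    -- `[H : pH] = 0` contradicts `[H : pH] ≤ [V : pV] ≠ 0`... unless it is `0` by infinitude; but `0 ≤ _` always: use divisibility
    -- instead: `pH ≤ H ≤ V` with `[V : pH] = [H : pH]·[V : H]` and `[V : pH] = [pV : pH]·[V : pV]`, all factors finite
    have e1 := AddSubgroup.relIndex_mul_relIndex _ N.range V (map_nsmul_le p N.range) hle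
    have e2 := AddSubgroup.relIndex_mul_relIndex _ (V.map (DistribSMul.toAddMonoidHom A p)) V
      (AddSubgroup.map_mono hle) (map_nsmul_le p V)
    rw [h0, zero_mul] at e1
    rw [← e1] at e2
    rcases mul_eq_zero.1 e2 with h | h
    · -- `[pV : pH] = 0` is impossible: it divides `[V : H] ≠ 0` (surjection `V/H ↠ pV/pH`), cf. the previous proof
      let φ := DistribSMul.toAddMonoidHom A p
      let f : ↥V →+ ↥(V.map φ) := (φ.comp V.subtype).codRestrict (V.map φ) fun x ↦ ⟨x, x.2, rfl⟩
      have hf : Function.Surjective f := by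
        rintro ⟨y, hy⟩
        obtain ⟨x, hx, rfl⟩ := hy
        exact ⟨⟨x, hx⟩, rfl⟩
      have hmap : (N.range.addSubgroupOf V).map f = (N.range.map φ).addSubgroupOf (V.map φ) := by
        ext ⟨y, hy⟩
        simp only [AddSubgroup.mem_map, AddSubgroup.mem_addSubgroupOf]
        constructor
        · rintro ⟨⟨x, hxV⟩, hxH, hxy⟩
          exact ⟨x, hxH, congrArg Subtype.val hxy⟩
        · rintro ⟨x, hxH, hxy⟩
          exact ⟨⟨x, hle hxH⟩, hxH, Subtype.ext hxy⟩
      have hd := AddSubgroup.index_map_dvd (N.range.addSubgroupOf V) hf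
      rw [hmap] at hd
      exact hfin (Nat.eq_zero_of_zero_dvd (h ▸ hd))
    · exact hV h
  obtain ⟨S, hSH, hScard, hScov⟩ := exists_finset_cover_of_relIndex _ N.range hfin'
  -- preimages of the representatives under `N`
  have hpre : ∀ s : A, ∃ s' : A, s ∈ S → N s' = s := fun s ↦ by
    by_cases hs : s ∈ S
    · obtain ⟨s', hs'⟩ := hSH s hs
      exact ⟨s', fun _ ↦ hs'⟩
    · exact ⟨0, fun h ↦ absurd h hs⟩
  choose g hg using hpre
  refine ⟨S.image g, Finset.card_image_le.trans (hScard.trans (hidx.trans hB)), fun a ↦ ?_⟩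
  obtain ⟨s, hs, hdiff⟩ := hScov (N a) ⟨a, rfl⟩
  obtain ⟨y, ⟨a', rfl⟩, hy⟩ := hdiff
  refine ⟨g s, Finset.mem_image_of_mem g hs, a', ?_⟩
  have : N a - N (g s) = p • N a' := by rw [hg s hs]; exact hy.symm
  rw [← this]; abel

end Index

/-! ### §3. The third cyclic input from LOCAL RECIPROCITY: `Fˣ/N_{E/F}(Eˣ)` is cyclic for cyclic `E/F` -/

/-- ★ **`Fˣ/N_{E/F}(Eˣ)` is CYCLIC for a finite cyclic extension `E ⊆ F̄` of a non-archimedean local field `F`** — the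
reciprocity isomorphism `Fˣ/N Eˣ ≅ Gal(E/F)` (the tree's PROVED `GaloisRepresentations.localReciprocityLaw_holds`, Serre XIII §4):
some `g ∈ Fˣ` (a lift of a generator of `Gal(E/F)`) has every `y ∈ Fˣ` of the form `g^k · N_{E/F}(z)`. Restricted to units
(`U_F ∩ N(Eˣ) = N(U_E)` by valuations) this is hypothesis (hT) of the devissage (`T = U_M/(U_{L₀}·N_{L/M}U_L)` cyclic, at
`F := M = L^I`, `E := L`). [cite: SerreLocalFields1979, Ch. XIII §4 Prop. 9 and Cor. to Prop. 8] -/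
theorem exists_generator_mod_norms (F : Type) [Field F] [ValuativeRel F] [TopologicalSpace F] [IsNonarchimedeanLocalField F]
    (E : IntermediateField F (AlgebraicClosure F)) [FiniteDimensional F E] [IsAbelianGalois F E] [IsCyclic (E ≃ₐ[F] E)] :
    ∃ g : Fˣ, ∀ y : Fˣ, ∃ (k : ℤ) (z : (↥E)ˣ), y = g ^ k * Units.map (Algebra.norm F : E →* F) z := by
  obtain ⟨θ, hθ⟩ := Literature.NumberTheory.GaloisRepresentations.localReciprocityLaw_holds F
  obtain ⟨hsurj, hker, -⟩ := hθ E
  obtain ⟨γ, hγ⟩ := IsCyclic.exists_generator (α := E ≃ₐ[F] E)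
  obtain ⟨g, hg⟩ := hsurj γ
  refine ⟨g, fun y ↦ ?_⟩
  obtain ⟨k, hk⟩ := Subgroup.mem_zpowers_iff.1 (hγ (θ E y))
  have hmem : y * (g ^ k)⁻¹ ∈ (θ E).ker := by
    rw [MonoidHom.mem_ker, map_mul, map_inv, map_zpow, hg, hk, mul_inv_cancel]
  rw [hker] at hmem
  obtain ⟨z, hz⟩ := hmem
  exact ⟨k, z, by rw [hz, mul_comm y, ← mul_assoc, mul_inv_cancel, one_mul]⟩

end Summit.BirchSwinnertonDyer.BirchSwinnertonDyer.Theorems.PrintCf2.LeopoldtAtV
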